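import Summits.QuantumFields.QCD.Theorems.HeatSlicedQuarksFreeKernelPowerCountingBounds
import Summits.QuantumFields.QCD.Theorems.SpectralDefectExtinctionTipNoBindingStubSobolevSup
import Mathlib.Analysis.Complex.CauchyIntegral
import Mathlib.Analysis.Complex.RealDeriv
import Mathlib.Analysis.Calculus.IteratedDeriv.Lemmas
import Mathlib.Analysis.Calculus.MeanValue
import Literature.MathematicalPhysics.QuantumLattice.LatticeTori

/-!
# Finite differences on the four-torus versus derivatives of the symbol
(helpers for stub `stub_freeKernelDecay` of line `point-centred-axial-parabolic`, crux
`Summit.QuantumFields.QCD.Theses.HeatSlicedQuarks.SmallFieldUltracontractivity`, item stmt-QuantumFields-8871)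

Discrete bookkeeping for the spatial decay of a torus Fourier sum `Σ_k F(k) χ_k(y)` on `(ℤ/L)⁴`:

* `sum_iterate_torusDiff_mul_torusChar` — multiplying by `(1 − conj χ_y(e_μ))ⁿ` applies the `n`-th
  forward difference `Δ_μ` in the momentum `k_μ` to `F` (summation by parts on the finite torus);
* `four_mul_cyclicAbs_div_le_norm` — `‖1 − conj χ_y(e_μ)‖ ≥ 4 |y_μ|_per / L` (Jordan's inequality);
* `iterate_torusDiff_eq_iterate_fwdDiff` — when `F(k) = Φ_k(θ_μ(k))` with `Φ_k` `2π`-periodic and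
  independent of `k_μ`, `Δ_μⁿ F(k)` is the `n`-th forward difference of step `2π/L` of `Φ_k` at
  `θ_μ(k) = 2π k_μ.val / L`;
* `norm_iterate_fwdDiff_le` — forward differences of step `q` of the restriction to `ℝ` of an entire
  function are bounded by `qⁿ · sup ‖e⁽ⁿ⁾‖` over the window `[θ, θ + nq]` (mean value inequality);
* `sum_zmod_exp_cos_le` — the Gaussian Riemann sum `Σ_j e^{−(σ/8)(1 − cos θ_j)} ≤ 12 L / √(1+σ)` for
  `0 ≤ σ ≤ L²` (from the tree's `sum_zmod_exp_upper`).

References: folklore (finite Fourier analysis, mean value theorem); pure theorem file (no definitions).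
-/

noncomputable section

namespace Summit.QuantumFields.QCD.Cruxes.SmallFieldUltracontractivity.PointCentredAxialParabolic

open Literature.Probability.LatticeModels (TorusSite torusChar torusChar_add_right torusChar_comm
  torusChar_mul_conj norm_torusChar)
open Summit.QuantumFields.QCD.Cruxes.TipNoBinding.PositivityNoLeakSpread (torusChar_single_eq_exp)
open scoped ComplexConjugate

/-! ### Forward differences of restrictions of entire functions -/

/-- **Finite differences versus derivatives.** For an entire `e : ℂ → ℂ`, `q ≥ 0` and `n`, if
`‖e⁽ⁿ⁾(t)‖ ≤ M` for all real `t ∈ [θ, θ + nq]`, then the `n`-th forward difference of step `q` of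
`s ↦ e(s)` at `θ` has norm `≤ qⁿ M` (induction on `n` with the mean value inequality). -/
theorem norm_iterate_fwdDiff_le {q : ℝ} (hq : 0 ≤ q) :
    ∀ (n : ℕ) (e : ℂ → ℂ), Differentiable ℂ e → ∀ (θ M : ℝ),
      (∀ t : ℝ, θ ≤ t → t ≤ θ + n * q → ‖iteratedDeriv n e t‖ ≤ M) →
      ‖((fun (Ψ : ℝ → ℂ) (s : ℝ) => Ψ s - Ψ (s + q))^[n] (fun s : ℝ => e s)) θ‖ ≤ q ^ n * M := by
  intro n
  induction n with
  | zero =>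
    intro e _ θ M hM
    have h := hM θ le_rfl (by simp)
    simpa using h
  | succ n ih =>
    intro e he θ M hM
    rw [Function.iterate_succ_apply]
    have hfun : (fun s : ℝ => (fun s : ℝ => e s) s - (fun s : ℝ => e s) (s + q)) =
        fun s : ℝ => (fun ζ : ℂ => e ζ - e (ζ + q)) (s : ℂ) := by
      funext s; simp only [Complex.ofReal_add]
    rw [hfun]
    have he' : Differentiable ℂ (fun ζ : ℂ => e ζ - e (ζ + q)) := by fun_prop
    -- the derivative bound for the differenced function, via the mean value inequality
    have hM' : ∀ t : ℝ, θ ≤ t → t ≤ θ + n * q →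
        ‖iteratedDeriv n (fun ζ : ℂ => e ζ - e (ζ + q)) t‖ ≤ q * M := by
      intro t ht1 ht2
      have hcd : ContDiff ℂ (n + 1 : ℕ) e := he.contDiff
      have hcdn : ContDiff ℂ n e := he.contDiff
      have hshift : ContDiff ℂ n (fun ζ : ℂ => e (ζ + q)) := hcdn.comp (contDiff_id.add contDiff_const)
      rw [iteratedDeriv_fun_sub hcdn.contDiffAt hshift.contDiffAt]
      have hc := congrFun (iteratedDeriv_comp_add_const n e (q : ℂ)) (t : ℂ)
      rw [hc]
      -- mean value inequality for `s ↦ e⁽ⁿ⁾(s)` on `[t, t + q]`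
      have hdiff : Differentiable ℂ (iteratedDeriv n e) := hcd.differentiable_iteratedDeriv' n
      have hderiv : ∀ s ∈ Set.Icc t (t + q),
          HasDerivWithinAt (fun s : ℝ => iteratedDeriv n e s) (iteratedDeriv (n + 1) e s)
            (Set.Icc t (t + q)) s := by
        intro s _
        have h1 : HasDerivAt (iteratedDeriv n e) (iteratedDeriv (n + 1) e s) (s : ℂ) := by
          rw [iteratedDeriv_succ]
          exact (hdiff (s : ℂ)).hasDerivAt
        exact h1.comp_ofReal.hasDerivWithinAt
      have hbound : ∀ s ∈ Set.Ico t (t + q), ‖iteratedDeriv (n + 1) e s‖ ≤ M := by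
        intro s hs
        refine hM s (ht1.trans hs.1) ?_
        have := hs.2
        push_cast
        linarith
      have hmvt := norm_image_sub_le_of_norm_deriv_le_segment' hderiv hbound (t + q)
        ⟨by linarith, le_rfl⟩
      rw [norm_sub_rev]
      have e1 : ((t : ℂ) + q) = ((t + q : ℝ) : ℂ) := by push_cast; ring
      rw [e1]
      calc ‖iteratedDeriv n e ((t + q : ℝ) : ℂ) - iteratedDeriv n e t‖ ≤ M * (t + q - t) := hmvt
        _ = q * M := by ring
    calc ‖((fun (Ψ : ℝ → ℂ) (s : ℝ) => Ψ s - Ψ (s + q))^[n]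
          (fun s : ℝ => (fun ζ : ℂ => e ζ - e (ζ + q)) (s : ℂ))) θ‖ ≤ q ^ n * (q * M) :=
          ih _ he' θ (q * M) hM'
      _ = q ^ (n + 1) * M := by ring

/-! ### Forward differences on the torus -/

/-- **Freezing the other momenta.** If `Φ k` does not depend on `k_μ` and is `2π`-periodic, then the
`n`-th torus forward difference in direction `μ` of `k ↦ Φ k (θ_μ(k))`, `θ_μ(k) = 2π k_μ.val / L`, is
the `n`-th forward difference of step `2π/L` of `Φ k` at `θ_μ(k)`. -/
theorem iterate_torusDiff_eq_iterate_fwdDiff {L : ℕ} [NeZero L] (μ : Fin 4) :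
    ∀ (n : ℕ) (Φ : TorusSite 4 L → ℝ → ℂ),
      (∀ k, Φ (k + Pi.single μ 1) = Φ k) → (∀ k t, Φ k (t + 2 * Real.pi) = Φ k t) →
      ∀ k, ((fun (G : TorusSite 4 L → ℂ) (k : TorusSite 4 L) => G k - G (k + Pi.single μ 1))^[n]
          (fun k => Φ k (2 * Real.pi * (ZMod.val (k μ) : ℝ) / L))) k =
        ((fun (Ψ : ℝ → ℂ) (s : ℝ) => Ψ s - Ψ (s + 2 * Real.pi / L))^[n] (Φ k))
          (2 * Real.pi * (ZMod.val (k μ) : ℝ) / L) := by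
  have hL : (0 : ℝ) < L := by exact_mod_cast Nat.pos_of_ne_zero (NeZero.ne L)
  intro n
  induction n with
  | zero => intro Φ _ _ k; simp
  | succ n ih =>
    intro Φ hind hper k
    rw [Function.iterate_succ_apply, Function.iterate_succ_apply]
    have hstep : (fun k : TorusSite 4 L =>
        (fun k : TorusSite 4 L => Φ k (2 * Real.pi * (ZMod.val (k μ) : ℝ) / L)) k -
          (fun k : TorusSite 4 L => Φ k (2 * Real.pi * (ZMod.val (k μ) : ℝ) / L))
            (k + Pi.single μ 1)) =
        fun k => (fun k s => Φ k s - Φ k (s + 2 * Real.pi / L)) k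
          (2 * Real.pi * (ZMod.val (k μ) : ℝ) / L) := by
      funext k
      simp only [hind k]
      congr 1
      -- `Φ k (θ_μ(k + e_μ)) = Φ k (θ_μ(k) + 2π/L)` by periodicity
      have hv : (k + Pi.single μ (1 : ZMod L) : TorusSite 4 L) μ =
          (((ZMod.val (k μ) + 1 : ℕ)) : ZMod L) := by
        rw [Pi.add_apply, Pi.single_eq_same, Nat.cast_add, Nat.cast_one, ZMod.natCast_zmod_val]
      rw [hv, ZMod.val_natCast]
      have hlt : ZMod.val (k μ) < L := ZMod.val_lt _
      rcases Nat.lt_or_ge (ZMod.val (k μ) + 1) L with h | h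
      · rw [Nat.mod_eq_of_lt h]
        congr 1
        push_cast
        ring
      · have heq : ZMod.val (k μ) + 1 = L := le_antisymm hlt h
        rw [heq, Nat.mod_self]
        have hcast : ((ZMod.val (k μ) : ℕ) : ℝ) = (L : ℝ) - 1 := by
          have : ((ZMod.val (k μ) + 1 : ℕ) : ℝ) = (L : ℝ) := by rw [heq]
          push_cast at this
          linarith
        rw [hcast]
        have e1 : 2 * Real.pi * ((L : ℝ) - 1) / L + 2 * Real.pi / L = 0 + 2 * Real.pi := by
          field_simp; ring
        rw [e1, hper]
        simp
    rw [hstep]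
    exact ih (fun k s => Φ k s - Φ k (s + 2 * Real.pi / L))
      (fun k => by simp only [hind])
      (fun k t => by
        rw [hper, show t + 2 * Real.pi + 2 * Real.pi / L = (t + 2 * Real.pi / L) + 2 * Real.pi by ring,
          hper]) k

/-- Multiplication by a `k_μ`-independent weight commutes with the torus forward difference:
`Δ_μⁿ (p · F)(k) = p(k) · Δ_μⁿ F(k)`. -/
theorem iterate_torusDiff_mul {L : ℕ} [NeZero L] (μ : Fin 4) (p : TorusSite 4 L → ℂ)
    (hp : ∀ k, p (k + Pi.single μ 1) = p k) :
    ∀ (n : ℕ) (F : TorusSite 4 L → ℂ) (k : TorusSite 4 L),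
      ((fun (G : TorusSite 4 L → ℂ) (k : TorusSite 4 L) => G k - G (k + Pi.single μ 1))^[n]
          (fun k => p k * F k)) k =
        p k * ((fun (G : TorusSite 4 L → ℂ) (k : TorusSite 4 L) => G k - G (k + Pi.single μ 1))^[n]
          F) k := by
  intro n
  induction n with
  | zero => intro F k; simp
  | succ n ih =>
    intro F k
    rw [Function.iterate_succ_apply, Function.iterate_succ_apply]
    have : (fun k : TorusSite 4 L => (fun k : TorusSite 4 L => p k * F k) k -
        (fun k : TorusSite 4 L => p k * F k) (k + Pi.single μ 1)) =
        fun k => p k * (fun k => F k - F (k + Pi.single μ 1)) k := by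
      funext k; simp only [hp k]; ring
    rw [this, ih]

/-! ### Summation by parts on the finite torus -/

/-- **Summation by parts.** For every `F : (ℤ/L)⁴ → ℂ`, `y` and `n`:
`Σ_k (Δ_μⁿ F)(k) χ_k(y) = (1 − conj χ_y(e_μ))ⁿ Σ_k F(k) χ_k(y)`. -/
theorem sum_iterate_torusDiff_mul_torusChar {L : ℕ} [NeZero L] (μ : Fin 4) (y : TorusSite 4 L) :
    ∀ (n : ℕ) (F : TorusSite 4 L → ℂ),
      ∑ k, ((fun (G : TorusSite 4 L → ℂ) (k : TorusSite 4 L) => G k - G (k + Pi.single μ 1))^[n] F) k *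
          torusChar k y =
        (1 - conj (torusChar y (Pi.single μ 1))) ^ n * ∑ k, F k * torusChar k y := by
  intro n
  induction n with
  | zero => intro F; simp
  | succ n ih =>
    intro F
    rw [Function.iterate_succ_apply, ih, pow_succ, mul_assoc]
    congr 1
    simp only [sub_mul, Finset.sum_sub_distrib, one_mul]
    congr 1
    rw [Finset.mul_sum]
    refine Fintype.sum_equiv (Equiv.addRight (Pi.single μ 1)) _ _ (fun k => ?_)
    simp only [Equiv.coe_addRight]
    rw [torusChar_comm (k + Pi.single μ 1) y, torusChar_add_right, ← torusChar_comm k y]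
    have h := torusChar_mul_conj y (Pi.single μ 1)
    linear_combination (-(F (k + Pi.single μ 1) * torusChar k y)) * h

/-- Norm form of summation by parts:
`‖1 − conj χ_y(e_μ)‖ⁿ ‖Σ_k F(k) χ_k(y)‖ ≤ Σ_k ‖(Δ_μⁿ F)(k)‖`. -/
theorem norm_pow_mul_norm_sum_le {L : ℕ} [NeZero L] (μ : Fin 4) (y : TorusSite 4 L) (n : ℕ)
    (F : TorusSite 4 L → ℂ) :
    ‖1 - conj (torusChar y (Pi.single μ 1))‖ ^ n * ‖∑ k, F k * torusChar k y‖ ≤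
      ∑ k, ‖((fun (G : TorusSite 4 L → ℂ) (k : TorusSite 4 L) => G k - G (k + Pi.single μ 1))^[n] F) k‖ := by
  rw [← norm_pow, ← norm_mul, ← sum_iterate_torusDiff_mul_torusChar]
  refine (norm_sum_le _ _).trans (le_of_eq (Finset.sum_congr rfl fun k _ => ?_))
  rw [norm_mul, norm_torusChar, mul_one]

/-! ### The multiplier `1 − conj χ_y(e_μ)` and the periodic distance -/

/-- Jordan on both halves of the period: for `0 ≤ v ≤ L`, `0 < L`:
`2 min(v, L − v) / L ≤ sin (π v / L)`. -/
theorem two_mul_min_div_le_sin {L v : ℝ} (hL : 0 < L) (hv0 : 0 ≤ v) (hvL : v ≤ L) :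
    2 * min v (L - v) / L ≤ Real.sin (Real.pi * v / L) := by
  by_cases hv : 2 * v ≤ L
  · have hx : 0 ≤ Real.pi * v / L := by positivity
    have hx' : Real.pi * v / L ≤ Real.pi / 2 := by
      rw [div_le_div_iff₀ hL two_pos]; nlinarith [Real.pi_pos]
    have h := Real.mul_le_sin hx hx'
    calc 2 * min v (L - v) / L ≤ 2 * v / L := by
          gcongr; exact min_le_left _ _
      _ = 2 / Real.pi * (Real.pi * v / L) := by field_simp
      _ ≤ Real.sin (Real.pi * v / L) := h
  · push Not at hv
    have hx : 0 ≤ Real.pi * (L - v) / L := by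
      apply div_nonneg _ hL.le; exact mul_nonneg Real.pi_pos.le (by linarith)
    have hx' : Real.pi * (L - v) / L ≤ Real.pi / 2 := by
      rw [div_le_div_iff₀ hL two_pos]; nlinarith [Real.pi_pos]
    have h := Real.mul_le_sin hx hx'
    have hsin : Real.sin (Real.pi * (L - v) / L) = Real.sin (Real.pi * v / L) := by
      rw [show Real.pi * (L - v) / L = Real.pi - Real.pi * v / L by field_simp, Real.sin_pi_sub]
    calc 2 * min v (L - v) / L ≤ 2 * (L - v) / L := by
          gcongr; exact min_le_right _ _
      _ = 2 / Real.pi * (Real.pi * (L - v) / L) := by field_simp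
      _ ≤ Real.sin (Real.pi * (L - v) / L) := h
      _ = Real.sin (Real.pi * v / L) := hsin

/-- The conjugate character at a unit vector is `e^{−iθ}`: `conj χ_k(e_ν) = exp (−i θ_ν(k))`,
`θ_ν(k) = 2π k_ν.val / L`. -/
theorem conj_torusChar_single {L : ℕ} [NeZero L] (k : TorusSite 4 L) (ν : Fin 4) :
    conj (torusChar k (Pi.single ν 1)) =
      Complex.exp (-(Complex.I * ((2 * Real.pi * (ZMod.val (k ν) : ℝ) / L : ℝ) : ℂ))) := by
  rw [torusChar_single_eq_exp, ← Complex.exp_conj]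
  congr 1
  rw [map_mul, Complex.conj_ofReal, Complex.conj_I]
  ring

/-- `‖1 − conj χ_k(e_ν)‖ = 2 √((1 − cos θ_ν(k))/2)`. -/
theorem norm_one_sub_conj_torusChar_single {L : ℕ} [NeZero L] (k : TorusSite 4 L) (ν : Fin 4) :
    ‖1 - conj (torusChar k (Pi.single ν 1))‖ =
      2 * Real.sqrt ((1 - Real.cos (2 * Real.pi * (ZMod.val (k ν) : ℝ) / L)) / 2) := by
  rw [conj_torusChar_single]
  have h := Complex.norm_exp_I_mul_ofReal_sub_one (-(2 * Real.pi * (ZMod.val (k ν) : ℝ) / L))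
  rw [← Real.abs_sin_half, ← norm_sub_rev]
  have e1 : Complex.I * ((-(2 * Real.pi * (ZMod.val (k ν) : ℝ) / L) : ℝ) : ℂ) =
      -(Complex.I * ((2 * Real.pi * (ZMod.val (k ν) : ℝ) / L : ℝ) : ℂ)) := by push_cast; ring
  rw [e1] at h
  rw [h, Real.norm_eq_abs, abs_mul, abs_two, neg_div, Real.sin_neg, abs_neg]

/-- **The multiplier dominates the periodic distance**:
`4 · min(y_μ.val, L − y_μ.val) / L ≤ ‖1 − conj χ_y(e_μ)‖`. -/
theorem four_mul_cyclicAbs_div_le_norm {L : ℕ} [NeZero L] (y : TorusSite 4 L) (μ : Fin 4) :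
    4 * ((min (ZMod.val (y μ)) (L - ZMod.val (y μ)) : ℕ) : ℝ) / L ≤
      ‖1 - conj (torusChar y (Pi.single μ 1))‖ := by
  have hL : (0 : ℝ) < L := by exact_mod_cast Nat.pos_of_ne_zero (NeZero.ne L)
  have hvlt : ZMod.val (y μ) < L := ZMod.val_lt _
  rw [norm_one_sub_conj_torusChar_single, ← Real.abs_sin_half]
  have e1 : 2 * Real.pi * (ZMod.val (y μ) : ℝ) / L / 2 = Real.pi * (ZMod.val (y μ) : ℝ) / L := by ring
  rw [e1, Nat.cast_min, Nat.cast_sub hvlt.le]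
  have h := two_mul_min_div_le_sin hL (Nat.cast_nonneg (ZMod.val (y μ))) (by exact_mod_cast hvlt.le)
  calc 4 * min (ZMod.val (y μ) : ℝ) ((L : ℝ) - (ZMod.val (y μ) : ℝ)) / L
      = 2 * (2 * min (ZMod.val (y μ) : ℝ) ((L : ℝ) - (ZMod.val (y μ) : ℝ)) / L) := by ring
    _ ≤ 2 * Real.sin (Real.pi * (ZMod.val (y μ) : ℝ) / L) := by gcongr
    _ ≤ 2 * |Real.sin (Real.pi * (ZMod.val (y μ) : ℝ) / L)| := by gcongr; exact le_abs_self _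

/-- The torus norm is attained in some coordinate direction. -/
theorem exists_torusNorm_eq {L : ℕ} [NeZero L] (y : TorusSite 4 L) :
    ∃ μ : Fin 4, Literature.MathematicalPhysics.QuantumLattice.torusNorm y =
      min (ZMod.val (y μ)) (L - ZMod.val (y μ)) := by
  obtain ⟨μ, -, hμ⟩ := Finset.exists_mem_eq_sup (Finset.univ : Finset (Fin 4)) Finset.univ_nonempty
    (fun i => min (ZMod.val (y i)) (L - ZMod.val (y i)))
  exact ⟨μ, hμ⟩

/-! ### The Gaussian Riemann sum -/

/-- **Gaussian Riemann sum**, uniform in the side: for `L ≥ 1` and `0 ≤ σ ≤ L²`,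
`Σ_{j : ZMod L} e^{−(σ/8)(1 − cos (2π j.val/L))} ≤ 12 L / √(1+σ)`. -/
theorem sum_zmod_exp_cos_le (L : ℕ) [NeZero L] {σ : ℝ} (hσ : 0 ≤ σ) (hσL : σ ≤ (L : ℝ) ^ 2) :
    ∑ j : ZMod L, Real.exp (-(σ / 8 * (1 - Real.cos (2 * Real.pi * (j.val : ℝ) / L)))) ≤
      12 * L / Real.sqrt (1 + σ) := by
  have hL : (0 : ℝ) < L := by exact_mod_cast Nat.pos_of_ne_zero (NeZero.ne L)
  have hs : 0 < Real.sqrt (1 + σ) := Real.sqrt_pos.2 (by linarith)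
  -- rewrite the summand as `e^{-4 t sin²(π j / L)}` with `t = σ / 16`
  have hterm : ∀ j : ZMod L, Real.exp (-(σ / 8 * (1 - Real.cos (2 * Real.pi * (j.val : ℝ) / L)))) =
      Real.exp (-(4 * (σ / 16) * Real.sin (Real.pi * (j.val : ℝ) / L) ^ 2)) := by
    intro j
    congr 1
    have : Real.cos (2 * Real.pi * (j.val : ℝ) / L) =
        1 - 2 * Real.sin (Real.pi * (j.val : ℝ) / L) ^ 2 := by
      rw [show 2 * Real.pi * (j.val : ℝ) / L = 2 * (Real.pi * (j.val : ℝ) / L) by ring,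
        Real.cos_two_mul, Real.cos_sq']
      ring
    rw [this]; ring
  simp_rw [hterm]
  by_cases h16 : σ < 16
  · -- every term is at most one
    have hsum : ∑ j : ZMod L, Real.exp (-(4 * (σ / 16) * Real.sin (Real.pi * (j.val : ℝ) / L) ^ 2)) ≤ L := by
      calc _ ≤ ∑ _j : ZMod L, (1 : ℝ) := Finset.sum_le_sum fun j _ => by
              rw [Real.exp_le_one_iff]; nlinarith [sq_nonneg (Real.sin (Real.pi * (j.val : ℝ) / L))]
        _ = L := by simp
    have hsq : Real.sqrt (1 + σ) ≤ 5 := by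
      rw [Real.sqrt_le_left (by norm_num)]; linarith
    rw [le_div_iff₀ hs]
    nlinarith
  · push Not at h16
    have ht : (1 : ℝ) ≤ σ / 16 := by linarith
    have htL : σ / 16 ≤ (L : ℝ) ^ 2 := by nlinarith [sq_nonneg (L : ℝ)]
    have h := Summit.QuantumFields.QCD.Theorems.HeatSlicedQuarks.FreeKernel.sum_zmod_exp_upper L ht htL
    refine h.trans ?_
    have hst : 0 < Real.sqrt (σ / 16) := Real.sqrt_pos.2 (by linarith)
    rw [div_le_div_iff₀ hst hs]
    -- `2 √(1+σ) ≤ 12 √(σ/16)` since `1 + σ ≤ 2σ = 32 (σ/16)`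
    have hcmp : Real.sqrt (1 + σ) ≤ 6 * Real.sqrt (σ / 16) := by
      rw [show (6 : ℝ) * Real.sqrt (σ / 16) = Real.sqrt (6 ^ 2 * (σ / 16)) by
        rw [Real.sqrt_mul' _ (by linarith), Real.sqrt_sq (by norm_num)]]
      exact Real.sqrt_le_sqrt (by linarith)
    nlinarith [hL.le]

/-- **Registered sub-goal `stub_fkdTorusToolkit`**: the finite-difference / summation-by-parts
toolkit of this file, exported as one conjunction (forward differences vs derivatives, freezing,
weights, summation by parts, the multiplier vs the periodic distance, attainment of the torus norm,
the Gaussian Riemann sum, and the conjugate character at a unit vector). -/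
theorem stub_fkdTorusToolkit : (∀ (q : ℝ), 0 ≤ q → ∀ (n : ℕ) (e : ℂ → ℂ), Differentiable ℂ e → ∀ (θ M : ℝ), (∀ t : ℝ, θ ≤ t → t ≤ θ + n * q → ‖iteratedDeriv n e (t : ℂ)‖ ≤ M) → ‖((fun (Ψ : ℝ → ℂ) (s : ℝ) => Ψ s - Ψ (s + q))^[n] (fun s : ℝ => e (s : ℂ))) θ‖ ≤ q ^ n * M) ∧ (∀ (L : ℕ) [NeZero L] (μ : Fin 4) (n : ℕ) (Φ : Literature.Probability.LatticeModels.TorusSite 4 L → ℝ → ℂ), (∀ k, Φ (k + Pi.single μ 1) = Φ k) → (∀ k t, Φ k (t + 2 * Real.pi) = Φ k t) → ∀ k, ((fun (G : Literature.Probability.LatticeModels.TorusSite 4 L → ℂ) (k : Literature.Probability.LatticeModels.TorusSite 4 L) => G k - G (k + Pi.single μ 1))^[n] (fun k => Φ k (2 * Real.pi * (ZMod.val (k μ) : ℝ) / L))) k = ((fun (Ψ : ℝ → ℂ) (s : ℝ) => Ψ s - Ψ (s + 2 * Real.pi / L))^[n] (Φ k)) (2 * Real.pi * (ZMod.val (k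 μ) : ℝ) / L)) ∧ (∀ (L : ℕ) [NeZero L] (μ : Fin 4) (p : Literature.Probability.LatticeModels.TorusSite 4 L → ℂ), (∀ k, p (k + Pi.single μ 1) = p k) → ∀ (n : ℕ) (F : Literature.Probability.LatticeModels.TorusSite 4 L → ℂ) (k : Literature.Probability.LatticeModels.TorusSite 4 L), ((fun (G : Literature.Probability.LatticeModels.TorusSite 4 L → ℂ) (k : Literature.Probability.LatticeModels.TorusSite 4 L) => G k - G (k + Pi.single μ 1))^[n] (fun k => p k * F k)) k = p k * ((fun (G : Literature.Probability.LatticeModels.TorusSite 4 L → ℂ) (k : Literature.Probability.LatticeModels.TorusSite 4 L) => G k - G (k + Pi.single μ 1))^[n] F) k) ∧ (∀ (L : ℕ) [NeZero L] (μ : Fin 4) (y : Literature.Probability.LatticeModels.TorusSite 4 L) (n : ℕ) (F : Literature.Probability.LatticeModels.TorusSite 4 L → ℂ), ‖1 - conj (Literature.Probability.LatticeModels.torusChar y (Pi.single μ 1))‖ ^ n * ‖∑ k, F k * Literature.Probability.LatticeModels.torusChar k y‖ ≤ ∑ k, ‖((fun (G : Literature.Probability.LatticeModels.TorusSite 4 L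 → ℂ) (k : Literature.Probability.LatticeModels.TorusSite 4 L) => G k - G (k + Pi.single μ 1))^[n] F) k‖) ∧ (∀ (L : ℕ) [NeZero L] (y : Literature.Probability.LatticeModels.TorusSite 4 L) (μ : Fin 4), 4 * ((min (ZMod.val (y μ)) (L - ZMod.val (y μ)) : ℕ) : ℝ) / L ≤ ‖1 - conj (Literature.Probability.LatticeModels.torusChar y (Pi.single μ 1))‖) ∧ (∀ (L : ℕ) [NeZero L] (y : Literature.Probability.LatticeModels.TorusSite 4 L), ∃ μ : Fin 4, Literature.MathematicalPhysics.QuantumLattice.torusNorm y = min (ZMod.val (y μ)) (L - ZMod.val (y μ))) ∧ (∀ (L : ℕ) [NeZero L] (σ : ℝ), 0 ≤ σ → σ ≤ (L : ℝ) ^ 2 → ∑ j : ZMod L, Real.exp (-(σ / 8 * (1 - Real.cos (2 * Real.pi * (j.val : ℝ) / L)))) ≤ 12 * L / Real.sqrt (1 + σ)) ∧ (∀ (L : ℕ) [NeZero L] (k : Literature.Probability.LatticeModels.TorusSite 4 L) (ν : Fin 4), ‖1 - conj (Literature.Probability.LatticeModels.torusChar k (Pi.single ν 1))‖ = 2 *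 Real.sqrt ((1 - Real.cos (2 * Real.pi * (ZMod.val (k ν) : ℝ) / L)) / 2)) ∧ (∀ (L : ℕ) [NeZero L] (k : Literature.Probability.LatticeModels.TorusSite 4 L) (ν : Fin 4), conj (Literature.Probability.LatticeModels.torusChar k (Pi.single ν 1)) = Complex.exp (-(Complex.I * ((2 * Real.pi * (ZMod.val (k ν) : ℝ) / L : ℝ) : ℂ)))) :=
  ⟨fun _ hq => norm_iterate_fwdDiff_le hq,
    fun _ _ μ n Φ h1 h2 k => iterate_torusDiff_eq_iterate_fwdDiff μ n Φ h1 h2 k,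
    fun _ _ μ p hp => iterate_torusDiff_mul μ p hp,
    fun _ _ μ y n F => norm_pow_mul_norm_sum_le μ y n F,
    fun _ _ y μ => four_mul_cyclicAbs_div_le_norm y μ,
    fun _ _ y => exists_torusNorm_eq y,
    fun L _ _ hσ hσL => sum_zmod_exp_cos_le L hσ hσL,
    fun _ _ k ν => norm_one_sub_conj_torusChar_single k ν,
    fun _ _ k ν => conj_torusChar_single k ν⟩

end Summit.QuantumFields.QCD.Cruxes.SmallFieldUltracontractivity.PointCentredAxialParabolic

end
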